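import Mathlib

/-!
# PercRepro — explicit thresholds at every level: the arithmetic, part A (p9, S4)

Mathlib-only lemmas behind THEOREM P (`proofs/SUBCLAIM-S4-p9.md`, sub-claim S4 of the crux `C025`): the binomial
tail `16·Σ_{j≤K} C(n,j) ≤ 2^n` for `n ≥ 3K+5` (`sixteen_mul_sum_range_choose_le`), the ratio bound
`C(p+d,q)·(p+1)^q ≤ C(p+q,q)·(p+1+(d−q))^q` (`choose_mul_pow_le_choose_mul_pow`), a Bernoulli-type bound in `ℕ`
(`add_pow_mul_le_pow_mul`), and the two regime thresholds `N₁(q) = 2^{q+1}+2q²+4q+4`, `P₂(q) = 2^{q+1}+3q+2` of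
night-1's core theorem `core_all_corank_of_thresholds_of_bound` with the flat bound `B = 2^q − 1`
(`regime_one`, `regime_two`). Part B (`RankLevelSetExplicitArithB`) has the threshold `Tcore` and the polynomial
inequality; `RankLevelSetExplicitAll` assembles THEOREM P. Axioms: standard.
-/

namespace PercRepro

namespace ThmN

namespace Explicit

/-- `C(m+1, K)·(m+1−K) = C(m, K)·(m+1)` (Mathlib's `Nat.choose_mul_succ_eq`, oriented). -/
theorem choose_succ_mul_sub_eq (m K : ℕ) :
    (m + 1).choose K * (m + 1 - K) = m.choose K * (m + 1) :=
  (Nat.choose_mul_succ_eq m K).symm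

/-- The base of the tail: `C(3K+5, K) ≤ 2^{3K}`. -/
theorem choose_three_base (K : ℕ) : (3 * K + 5).choose K ≤ 2 ^ (3 * K) := by
  induction K with
  | zero => decide
  | succ K ih =>
    -- a = C(m,K), b = C(m+1,K), c = C(m+2,K), e = C(m+3,K), g = C(m+3,K+1), m = 3K+5
    have h1 := choose_succ_mul_sub_eq (3 * K + 5) K
    have h2 := choose_succ_mul_sub_eq (3 * K + 6) K
    have h3 := choose_succ_mul_sub_eq (3 * K + 7) K
    have h4 := Nat.choose_succ_right_eq (3 * K + 8) K
    have e1 : 3 * K + 5 + 1 - K = 2 * K + 6 := by omega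
    have e2 : 3 * K + 6 + 1 - K = 2 * K + 7 := by omega
    have e3 : 3 * K + 7 + 1 - K = 2 * K + 8 := by omega
    have e4 : 3 * K + 8 - K = 2 * K + 8 := by omega
    rw [e1] at h1; rw [e2] at h2; rw [e3] at h3; rw [e4] at h4
    simp only [show 3 * K + 5 + 1 = 3 * K + 6 from rfl, show 3 * K + 6 + 1 = 3 * K + 7 from rfl,
      show 3 * K + 7 + 1 = 3 * K + 8 from rfl] at h1 h2 h3
    set a := (3 * K + 5).choose K with ha
    set b := (3 * K + 6).choose K with hb
    set c := (3 * K + 7).choose K with hc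
    set e := (3 * K + 8).choose K with he
    set g := (3 * K + 8).choose (K + 1) with hg
    have hpoly : (3 * K + 6) * (3 * K + 7) * (3 * K + 8) ≤ 8 * ((K + 1) * (2 * K + 7) * (2 * K + 6)) := by
      nlinarith [Nat.zero_le K, Nat.zero_le (K * K), Nat.zero_le (K * K * K)]
    have key : g * ((K + 1) * (2 * K + 7) * (2 * K + 6)) = a * ((3 * K + 6) * (3 * K + 7) * (3 * K + 8)) := by
      calc g * ((K + 1) * (2 * K + 7) * (2 * K + 6))
          = (g * (K + 1)) * (2 * K + 7) * (2 * K + 6) := by ring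
        _ = (e * (2 * K + 8)) * (2 * K + 7) * (2 * K + 6) := by rw [h4]
        _ = (e * (2 * K + 8)) * (2 * K + 7) * (2 * K + 6) := rfl
        _ = (c * (3 * K + 8)) * (2 * K + 7) * (2 * K + 6) := by rw [h3]
        _ = (c * (2 * K + 7)) * (3 * K + 8) * (2 * K + 6) := by ring
        _ = (b * (3 * K + 7)) * (3 * K + 8) * (2 * K + 6) := by rw [h2]
        _ = (b * (2 * K + 6)) * (3 * K + 7) * (3 * K + 8) := by ring
        _ = (a * (3 * K + 6)) * (3 * K + 7) * (3 * K + 8) := by rw [h1]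
        _ = a * ((3 * K + 6) * (3 * K + 7) * (3 * K + 8)) := by ring
    have hpos : 0 < (K + 1) * (2 * K + 7) * (2 * K + 6) := by positivity
    have : g * ((K + 1) * (2 * K + 7) * (2 * K + 6)) ≤
        2 ^ (3 * (K + 1)) * ((K + 1) * (2 * K + 7) * (2 * K + 6)) := by
      calc g * ((K + 1) * (2 * K + 7) * (2 * K + 6))
          = a * ((3 * K + 6) * (3 * K + 7) * (3 * K + 8)) := key
        _ ≤ 2 ^ (3 * K) * (8 * ((K + 1) * (2 * K + 7) * (2 * K + 6))) :=
            Nat.mul_le_mul ih hpoly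
        _ = 2 ^ (3 * (K + 1)) * ((K + 1) * (2 * K + 7) * (2 * K + 6)) := by ring
    have hg' : g ≤ 2 ^ (3 * (K + 1)) := Nat.le_of_mul_le_mul_right this hpos
    simpa [hg, show 3 * (K + 1) + 5 = 3 * K + 8 from by ring] using hg'

/-- `C(n+1, K) ≤ 2·C(n, K)` once `2K ≤ n + 1`. -/
theorem choose_succ_le_two_mul (n K : ℕ) (h : 2 * K ≤ n + 1) : (n + 1).choose K ≤ 2 * n.choose K := by
  have h1 := choose_succ_mul_sub_eq n K
  have hpos : 0 < n + 1 - K := by omega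
  have : (n + 1).choose K * (n + 1 - K) ≤ 2 * n.choose K * (n + 1 - K) := by
    calc (n + 1).choose K * (n + 1 - K) = n.choose K * (n + 1) := h1
      _ ≤ n.choose K * (2 * (n + 1 - K)) := Nat.mul_le_mul_left _ (by omega)
      _ = 2 * n.choose K * (n + 1 - K) := by ring
  exact Nat.le_of_mul_le_mul_right this hpos

/-- **The tail base at every `K`**: `32·C(n, K) ≤ 2^n` for every `n ≥ 3K + 5`. -/
theorem choose_mul_thirtytwo_le_two_pow (K : ℕ) : ∀ n, 3 * K + 5 ≤ n → 32 * n.choose K ≤ 2 ^ n := by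
  intro n hn
  induction n, hn using Nat.le_induction with
  | base =>
    have := choose_three_base K
    calc 32 * (3 * K + 5).choose K ≤ 32 * 2 ^ (3 * K) := Nat.mul_le_mul_left _ this
      _ = 2 ^ (3 * K + 5) := by ring
  | succ n hn ih =>
    have h := choose_succ_le_two_mul n K (by omega)
    calc 32 * (n + 1).choose K ≤ 32 * (2 * n.choose K) := Nat.mul_le_mul_left _ h
      _ = 2 * (32 * n.choose K) := by ring
      _ ≤ 2 * 2 ^ n := Nat.mul_le_mul_left _ ih
      _ = 2 ^ (n + 1) := by ring

/-- `Σ_{j ≤ K} C(n, j) ≤ 2·C(n, K)` for `n ≥ 3K + 2` (the ratio `C(n,j)/C(n,j+1) ≤ 1/2` below `K`). -/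
theorem sum_range_choose_le_two_mul_choose (n : ℕ) : ∀ K, 3 * K + 2 ≤ n →
    ∑ j ∈ Finset.range (K + 1), n.choose j ≤ 2 * n.choose K := by
  intro K
  induction K with
  | zero => intro _; simp
  | succ K ih =>
    intro hn
    have h1 := ih (by omega)
    -- 2·C(n,K) ≤ C(n,K+1): C(n,K+1)·(K+1) = C(n,K)·(n−K) ≥ C(n,K)·(2(K+1))
    have h2 : 2 * n.choose K ≤ n.choose (K + 1) := by
      have e := Nat.choose_succ_right_eq n K
      have hpos : 0 < K + 1 := by omega
      have : 2 * n.choose K * (K + 1) ≤ n.choose (K + 1) * (K + 1) := by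
        calc 2 * n.choose K * (K + 1) = n.choose K * (2 * (K + 1)) := by ring
          _ ≤ n.choose K * (n - K) := Nat.mul_le_mul_left _ (by omega)
          _ = n.choose (K + 1) * (K + 1) := e.symm
      exact Nat.le_of_mul_le_mul_right this hpos
    rw [Finset.sum_range_succ]
    omega

/-- **THE TAIL**: `16·Σ_{j ≤ K} C(n, j) ≤ 2^n` for every `n ≥ 3K + 5`. -/
theorem sixteen_mul_sum_range_choose_le (K n : ℕ) (hn : 3 * K + 5 ≤ n) :
    16 * ∑ j ∈ Finset.range (K + 1), n.choose j ≤ 2 ^ n := by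
  have h1 := sum_range_choose_le_two_mul_choose n K (by omega)
  have h2 := choose_mul_thirtytwo_le_two_pow K n hn
  omega


/-- **Ratio lemma**: `C(p+d, q)·(p+1)^q ≤ C(p+q, q)·(p+1+(d−q))^q` for `q ≤ d` (termwise in the falling
factorials: `(p+d−i)(p+1) ≤ (p+q−i)(p+1+(d−q))` for `i < q`). -/
theorem choose_mul_pow_le_choose_mul_pow (p q d : ℕ) (hqd : q ≤ d) :
    (p + d).choose q * (p + 1) ^ q ≤ (p + q).choose q * (p + 1 + (d - q)) ^ q := by
  have hfac : 0 < q.factorial := Nat.factorial_pos q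
  apply Nat.le_of_mul_le_mul_left _ hfac
  have e1 : q.factorial * ((p + d).choose q * (p + 1) ^ q) =
      (∏ i ∈ Finset.range q, (p + d - i)) * ∏ _i ∈ Finset.range q, (p + 1) := by
    rw [← mul_assoc, ← Nat.descFactorial_eq_factorial_mul_choose, Nat.descFactorial_eq_prod_range,
      Finset.prod_const, Finset.card_range]
  have e2 : q.factorial * ((p + q).choose q * (p + 1 + (d - q)) ^ q) =
      (∏ i ∈ Finset.range q, (p + q - i)) * ∏ _i ∈ Finset.range q, (p + 1 + (d - q)) := by
    rw [← mul_assoc, ← Nat.descFactorial_eq_factorial_mul_choose, Nat.descFactorial_eq_prod_range,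
      Finset.prod_const, Finset.card_range]
  rw [e1, e2, ← Finset.prod_mul_distrib, ← Finset.prod_mul_distrib]
  apply Finset.prod_le_prod (fun i _ => Nat.zero_le _)
  intro i hi
  rw [Finset.mem_range] at hi
  have : p + d - i = (p + q - i) + (d - q) := by omega
  rw [this]
  have hpq : p + 1 ≤ p + q - i := by omega
  calc (p + q - i + (d - q)) * (p + 1) = (p + q - i) * (p + 1) + (d - q) * (p + 1) := by ring
    _ ≤ (p + q - i) * (p + 1) + (d - q) * (p + q - i) := by
        apply Nat.add_le_add_left; exact Nat.mul_le_mul_left _ hpq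
    _ = (p + q - i) * (p + 1 + (d - q)) := by ring

/-- **Bernoulli in `ℕ`**: `(a + m)^q · a ≤ a^q · (a + 2qm)` whenever `2qm ≤ a`. -/
theorem add_pow_mul_le_pow_mul (a m : ℕ) : ∀ q, 2 * q * m ≤ a → (a + m) ^ q * a ≤ a ^ q * (a + 2 * q * m) := by
  intro q
  induction q with
  | zero => intro _; simp
  | succ q ih =>
    intro h
    have h' : 2 * q * m ≤ a := by nlinarith
    have ih' := ih h'
    have hm : m * (2 * q * m) ≤ m * a := Nat.mul_le_mul_left m h'
    calc (a + m) ^ (q + 1) * a = ((a + m) ^ q * a) * (a + m) := by ring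
      _ ≤ (a ^ q * (a + 2 * q * m)) * (a + m) := Nat.mul_le_mul_right _ ih'
      _ = a ^ q * ((a + 2 * q * m) * (a + m)) := by ring
      _ ≤ a ^ q * (a * (a + 2 * (q + 1) * m)) := by
          apply Nat.mul_le_mul_left; nlinarith
      _ = a ^ (q + 1) * (a + 2 * (q + 1) * m) := by ring

/-- `4m + 1 ≤ 2^m` for `m ≥ 5`. -/
theorem four_mul_add_one_le_two_pow (m : ℕ) (hm : 5 ≤ m) : 4 * m + 1 ≤ 2 ^ m := by
  induction m, hm using Nat.le_induction with
  | base => decide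
  | succ m hm ih =>
    calc 4 * (m + 1) + 1 = 4 * m + 5 := by ring
      _ ≤ 2 * (4 * m + 1) := by omega
      _ ≤ 2 * 2 ^ m := Nat.mul_le_mul_left _ ih
      _ = 2 ^ (m + 1) := by ring

/-- `q + 1 ≤ 2^q`. -/
theorem succ_le_two_pow (q : ℕ) : q + 1 ≤ 2 ^ q := Nat.lt_two_pow_self

/-- **(A3)** `2^j + q ≤ 2^q + j` for `j ≤ q`. -/
theorem two_pow_add_le_two_pow_add (j q : ℕ) (h : j ≤ q) : 2 ^ j + q ≤ 2 ^ q + j := by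
  obtain ⟨k, rfl⟩ := Nat.exists_eq_add_of_le h
  have hk := succ_le_two_pow k
  have hj : 1 ≤ 2 ^ j := Nat.one_le_two_pow
  rw [pow_add]
  nlinarith

/-- `n^{2q} ≤ (4q)^{2q} · 2^n` for `n ≥ 4q` (through `C(n, 2q) ≤ 2^n` and the falling factorial). -/
theorem pow_two_mul_le_pow_mul_two_pow (q n : ℕ) (hn : 4 * q ≤ n) :
    n ^ (2 * q) ≤ 2 ^ (2 * q) * (2 * q) ^ (2 * q) * 2 ^ n := by
  have h1 : (n + 1 - 2 * q) ^ (2 * q) ≤ n.descFactorial (2 * q) := Nat.pow_sub_le_descFactorial n (2 * q)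
  rw [Nat.descFactorial_eq_factorial_mul_choose] at h1
  have h2 : (2 * q).factorial ≤ (2 * q) ^ (2 * q) := Nat.factorial_le_pow (2 * q)
  have h3 : n.choose (2 * q) ≤ 2 ^ n := Nat.choose_le_two_pow n (2 * q)
  have h4 : n ≤ 2 * (n + 1 - 2 * q) := by omega
  calc n ^ (2 * q) ≤ (2 * (n + 1 - 2 * q)) ^ (2 * q) := Nat.pow_le_pow_left h4 _
    _ = 2 ^ (2 * q) * (n + 1 - 2 * q) ^ (2 * q) := by rw [mul_pow]
    _ ≤ 2 ^ (2 * q) * ((2 * q).factorial * n.choose (2 * q)) := Nat.mul_le_mul_left _ h1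
    _ ≤ 2 ^ (2 * q) * ((2 * q) ^ (2 * q) * 2 ^ n) := Nat.mul_le_mul_left _ (Nat.mul_le_mul h2 h3)
    _ = 2 ^ (2 * q) * (2 * q) ^ (2 * q) * 2 ^ n := by ring

/-- **(A1)** the first regime threshold: `8(q+1)·2^{2^q−1−q}·n^q ≤ 2^n` for every
`n ≥ N₁(q) = 2^{q+1} + 2q² + 4q + 4`. -/
theorem regime_one (q : ℕ) (n : ℕ) (hn : 2 ^ (q + 1) + 2 * q ^ 2 + 4 * q + 4 ≤ n) :
    8 * (q + 1) * 2 ^ (2 ^ q - 1 - q) * n ^ q ≤ 2 ^ n := by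
  have hq1 := succ_le_two_pow q
  set e := 2 ^ q - 1 - q with he
  have hee : e + q + 1 = 2 ^ q := by omega
  have hN : 2 ^ (q + 1) + 2 * q ^ 2 + 4 * q + 4 = 2 * e + 2 * q ^ 2 + 6 * q + 6 := by
    rw [pow_succ, ← hee]; ring
  have hn4 : 4 * q ≤ n := by omega
  have hX : (8 * (q + 1) * 2 ^ e) ^ 2 * (2 ^ (2 * q) * (2 * q) ^ (2 * q)) ≤
      2 ^ (2 ^ (q + 1) + 2 * q ^ 2 + 4 * q + 4) := by
    have h2q : 2 * q ≤ 2 ^ (q + 1) := by rw [pow_succ]; omega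
    calc (8 * (q + 1) * 2 ^ e) ^ 2 * (2 ^ (2 * q) * (2 * q) ^ (2 * q))
        = 64 * (q + 1) ^ 2 * (2 ^ e) ^ 2 * (2 ^ (2 * q) * (2 * q) ^ (2 * q)) := by ring
      _ ≤ 64 * (2 ^ q) ^ 2 * (2 ^ e) ^ 2 * (2 ^ (2 * q) * (2 ^ (q + 1)) ^ (2 * q)) := by gcongr
      _ = 2 ^ (2 ^ (q + 1) + 2 * q ^ 2 + 4 * q + 4) := by rw [hN]; ring
  have hsq : (8 * (q + 1) * 2 ^ e * n ^ q) ^ 2 ≤ (2 ^ n) ^ 2 := by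
    calc (8 * (q + 1) * 2 ^ e * n ^ q) ^ 2 = (8 * (q + 1) * 2 ^ e) ^ 2 * n ^ (2 * q) := by ring
      _ ≤ (8 * (q + 1) * 2 ^ e) ^ 2 * (2 ^ (2 * q) * (2 * q) ^ (2 * q) * 2 ^ n) :=
          Nat.mul_le_mul_left _ (pow_two_mul_le_pow_mul_two_pow q n hn4)
      _ = (8 * (q + 1) * 2 ^ e) ^ 2 * (2 ^ (2 * q) * (2 * q) ^ (2 * q)) * 2 ^ n := by ring
      _ ≤ 2 ^ (2 ^ (q + 1) + 2 * q ^ 2 + 4 * q + 4) * 2 ^ n := Nat.mul_le_mul_right _ hX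
      _ ≤ 2 ^ n * 2 ^ n := Nat.mul_le_mul_right _ (Nat.pow_le_pow_right (by norm_num) hn)
      _ = (2 ^ n) ^ 2 := by ring
  exact (Nat.pow_le_pow_iff_left (by norm_num)).mp hsq

/-- **(A2)** the second regime threshold: `2^{p+q}·2^{2^q−1−q}·(2(p−1−q)+1) ≤ 4^{p−1−q}` for
`p ≥ P₂(q) = 2^{q+1} + 3q + 2`. -/
theorem regime_two (q : ℕ) (hq : 2 ≤ q) (p : ℕ) (hp : 2 ^ (q + 1) + 3 * q + 2 ≤ p) :
    2 ^ (p + q) * 2 ^ (2 ^ q - 1 - q) * (2 * (p - 1 - q) + 1) ≤ 4 ^ (p - 1 - q) := by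
  have hq1 := succ_le_two_pow q
  have hq4 : 4 ≤ 2 ^ q := by
    calc 4 = 2 ^ 2 := by norm_num
      _ ≤ 2 ^ q := Nat.pow_le_pow_right (by norm_num) hq
  set a := p - 1 - q with ha
  set e := 2 ^ q - 1 - q with he
  have hee : e + q + 1 = 2 ^ q := by omega
  have hpa : p + q = a + 2 * q + 1 := by omega
  have hm : 2 ^ (q + 1) + 2 * q + 1 ≤ a := by rw [pow_succ] at hp ⊢; omega
  set m := a - q - 2 ^ q with hm'
  have hm5 : 5 ≤ m := by omega
  have hmm : a = m + q + 2 ^ q := by omega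
  have h41 := four_mul_add_one_le_two_pow m hm5
  have hlhs : 2 ^ (p + q) * 2 ^ e * (2 * a + 1) = 2 ^ (a + q + 2 ^ q) * (2 * a + 1) := by
    have hexp : a + 2 * q + 1 + e = a + q + 2 ^ q := by omega
    rw [hpa, ← pow_add, hexp]
  have h2a : 2 * a + 1 ≤ 2 ^ m := by
    calc 2 * a + 1 = 2 * m + 2 * q + 2 * 2 ^ q + 1 := by rw [hmm]; ring
      _ ≤ 4 * m + 1 := by omega
      _ ≤ 2 ^ m := h41
  calc 2 ^ (p + q) * 2 ^ e * (2 * a + 1) = 2 ^ (a + q + 2 ^ q) * (2 * a + 1) := hlhs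
    _ ≤ 2 ^ (a + q + 2 ^ q) * 2 ^ m := Nat.mul_le_mul_left _ h2a
    _ = 2 ^ (a + q + 2 ^ q + m) := by rw [← pow_add]
    _ = 2 ^ (2 * a) := by
        have hexp : a + q + 2 ^ q + m = 2 * a := by omega
        rw [hexp]
    _ = 4 ^ a := by rw [pow_mul]; norm_num

/-- `Σ_{j < R} C(F, j) ≤ 2^F` for every `R` (the terms beyond `F` vanish). -/
theorem sum_range_choose_le_two_pow (F R : ℕ) : ∑ j ∈ Finset.range R, F.choose j ≤ 2 ^ F := by
  rcases Nat.lt_or_ge (F + 1) R with h | h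
  · have : ∑ j ∈ Finset.range R, F.choose j = ∑ j ∈ Finset.range (F + 1), F.choose j := by
      symm
      apply Finset.sum_subset (Finset.range_mono h.le)
      intro j hj hj'
      rw [Finset.mem_range] at hj hj'
      exact Nat.choose_eq_zero_of_lt (by omega)
    rw [this, Nat.sum_range_choose]
  · calc ∑ j ∈ Finset.range R, F.choose j ≤ ∑ j ∈ Finset.range (F + 1), F.choose j :=
          Finset.sum_le_sum_of_subset_of_nonneg (Finset.range_mono h) (fun _ _ _ => Nat.zero_le _)
      _ = 2 ^ F := Nat.sum_range_choose F

/-- `C(n, a) ≤ C(n, b)` for `a ≤ b ≤ n/2`. -/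
theorem choose_le_choose_of_le_half (n a b : ℕ) (hab : a ≤ b) (hb : b ≤ n / 2) : n.choose a ≤ n.choose b := by
  induction b, hab using Nat.le_induction with
  | base => exact le_rfl
  | succ b hab ih =>
    have h1 := ih (by omega)
    have h2 : n.choose b ≤ n.choose (b + 1) := Nat.choose_le_succ_of_lt_half_left (by omega)
    exact h1.trans h2

end Explicit

end ThmN

end PercRepro
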